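import Summits.Ventures.YMGap.FlowData.RectTubeTransferPositivity
import Summits.Ventures.YMGap.FlowData.RectTubePolyakovLine
import HarnessLib

/-!
# Venture YMGap, track Y3 FLOW-DATA — GAUGE INVARIANCE of the RECTANGULAR tube transfer operator:
# `T ∘ G_γ = T = G_γ ∘ T` for every gauge transformation `γ` of the slice `Π_i ℤ/(Ls i)` (theorems only)

HONEST FRAMING: venture file of the cell `pub-ymgap` (QuantumFields programme), track Y3; the v2 (rectangular,
`FlowData/RectTubeTransferOperator.lean`) twin of `FlowData/TubeGaugeInvariance.lean`, first brick of the rectangular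
port of the strong-coupling window chain (STEP R2 of the seat's plan).  For a gauge transformation
`γ : RectTorusSite Ls → G` the written-out action on the spatial links is `U ↦ (e ↦ γ(x) U_e γ(x + e_i)⁻¹)` (as in
`RectTubeTransferPositivity.measurePreserving_rectGauge`, `RectTubePolyakovLine.rectMagSum_gauge`; no new definition);
`G_γ ψ = ψ ∘ (·)^γ` is the induced isometry of `L²` (`Lp.compMeasurePreservingₗᵢ`).  The rectangular slice kernel is
invariant in each argument (`rectSliceKernel_gauge_right/left`), hence **`rectTubeTransferOperator_comp_gaugeOp :
T ∘ G_γ = T`** and **`gaugeOp_comp_rectTubeTransferOperator : G_γ ∘ T = T`**.  Finite spatial torus; no number, no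
row, nothing about limits, the continuum or a mass gap.

References: M. Lüscher, Commun. Math. Phys. 54 (1977) 283 [cite: Luscher1977]; I. Montvay, G. Münster (1994) §3.2.6
[cite: MontvayMunster1994, §3.2.6 (3.137)–(3.146)].
-/

noncomputable section

open scoped BigOperators ENNReal
open MeasureTheory Filter Function
open Literature.MathematicalPhysics.QuantumFieldTheory Literature.Analysis.OperatorTheory
open Literature.MathematicalPhysics.QuantumLattice (RectTorusSite)

namespace Summit.Ventures.YMGap.FlowData

section Kernel

variable {G : Type*} [Group G] [TopologicalSpace G] [IsTopologicalGroup G] [CompactSpace G]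
  [MeasurableSpace G] [BorelSpace G] {n k : ℕ} (ρ : G →* Matrix (Fin n) (Fin n) ℂ) {Ls : Fin k → ℕ}
  [∀ i, NeZero (Ls i)]

/-- **The rectangular slice kernel is invariant under a gauge transformation of its second argument**:
`K(a, b^γ) = K(a, b)` (right-invariance of the Haar integral over the temporal links). [cite: Luscher1977] -/
theorem rectSliceKernel_gauge_right (γ : RectTorusSite Ls → G) (JE JM : ℝ) (a b : RectSlice Ls G) :
    rectSliceKernel (Ls := Ls) ρ JE JM a (fun e => γ e.1 * b e * (γ (e.1 + Pi.single e.2 1))⁻¹) =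
      rectSliceKernel (Ls := Ls) ρ JE JM a b := by
  unfold rectSliceKernel
  rw [rectMagSum_gauge]
  simp_rw [rectElecSum_gauge_right]
  rw [integral_mul_right_eq_self
    (fun E : RectTorusSite Ls → G => Real.exp (JE * rectElecSum (Ls := Ls) ρ a E b)) γ]

/-- **… and of its first argument** (unitary `ρ`, by the symmetry of the kernel): `K(a^γ, b) = K(a, b)`.
[cite: Luscher1977] -/
theorem rectSliceKernel_gauge_left (hρu : ∀ g, ρ g ∈ Matrix.unitaryGroup (Fin n) ℂ) (γ : RectTorusSite Ls → G)
    (JE JM : ℝ) (a b : RectSlice Ls G) :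
    rectSliceKernel (Ls := Ls) ρ JE JM (fun e => γ e.1 * a e * (γ (e.1 + Pi.single e.2 1))⁻¹) b =
      rectSliceKernel (Ls := Ls) ρ JE JM a b := by
  rw [rectSliceKernel_symm (Ls := Ls) ρ hρu, rectSliceKernel_gauge_right,
    rectSliceKernel_symm (Ls := Ls) ρ hρu]

end Kernel

section Operator

variable {G : Type*} [Group G] [TopologicalSpace G] [IsTopologicalGroup G] [CompactSpace G]
  [MeasurableSpace G] [BorelSpace G] [SecondCountableTopology G] {n : ℕ} (ρ : G →* Matrix (Fin n) (Fin n) ℂ)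
  (J : ℝ) {k : ℕ} {Ls : Fin k → ℕ} [∀ i, NeZero (Ls i)]

/-- **`T ∘ G_γ = T`** on the rectangular tube: applying `T` after pulling back by any gauge transformation changes
nothing (continuous `ρ`). [cite: Luscher1977] [cite: MontvayMunster1994, §3.2.6 (3.137)–(3.146)] -/
theorem rectTubeTransferOperator_comp_gaugeOp (hρ : Continuous ρ) (γ : RectTorusSite Ls → G) :
    (rectTubeTransferOperator ρ J Ls).comp
        (Lp.compMeasurePreservingₗᵢ ℝ
          (fun (U : RectSlice Ls G) (e : RectTorusSite Ls × Fin k) => γ e.1 * U e * (γ (e.1 + Pi.single e.2 1))⁻¹)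
          (measurePreserving_rectGauge γ)).toContinuousLinearMap =
      rectTubeTransferOperator ρ J Ls := by
  have hmp : MeasurePreserving
      (fun (U : RectSlice Ls G) (e : RectTorusSite Ls × Fin k) => γ e.1 * U e * (γ (e.1 + Pi.single e.2 1))⁻¹)
      (rectSliceMeasure G Ls) (rectSliceMeasure G Ls) := measurePreserving_rectGauge γ
  have hKc : Continuous (uncurry (rectSliceKernel (Ls := Ls) ρ J J)) :=
    continuous_rectSliceKernel (Ls := Ls) ρ hρ J J
  refine ContinuousLinearMap.ext fun φ => Lp.ext ?_
  rw [ContinuousLinearMap.comp_apply]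
  have hcs : ((Lp.compMeasurePreservingₗᵢ ℝ
      (fun (U : RectSlice Ls G) (e : RectTorusSite Ls × Fin k) => γ e.1 * U e * (γ (e.1 + Pi.single e.2 1))⁻¹) hmp)
      |>.toContinuousLinearMap φ : RectSlice Ls G → ℝ) =ᵐ[rectSliceMeasure G Ls]
        (φ : RectSlice Ls G → ℝ) ∘
          (fun (U : RectSlice Ls G) (e : RectTorusSite Ls × Fin k) => γ e.1 * U e * (γ (e.1 + Pi.single e.2 1))⁻¹) :=
    Lp.coeFn_compMeasurePreserving φ hmp
  refine (rectTubeTransferOperator_ae_eq J Ls hρ _).trans ((rectTubeTransferOperator_ae_eq J Ls hρ φ).trans ?_).symm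
  refine Eventually.of_forall fun a => ?_
  have h1 : ∫ b, rectSliceKernel (Ls := Ls) ρ J J a b * ((Lp.compMeasurePreservingₗᵢ ℝ
        (fun (U : RectSlice Ls G) (e : RectTorusSite Ls × Fin k) => γ e.1 * U e * (γ (e.1 + Pi.single e.2 1))⁻¹)
          hmp).toContinuousLinearMap φ : RectSlice Ls G → ℝ) b ∂(rectSliceMeasure G Ls) =
      ∫ b, rectSliceKernel (Ls := Ls) ρ J J a b *
        φ (fun e : RectTorusSite Ls × Fin k => γ e.1 * b e * (γ (e.1 + Pi.single e.2 1))⁻¹) ∂(rectSliceMeasure G Ls) := by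
    refine integral_congr_ae ?_
    filter_upwards [hcs] with b hb
    rw [hb, Function.comp_apply]
  have h2 : ∫ b, rectSliceKernel (Ls := Ls) ρ J J a b *
        φ (fun e : RectTorusSite Ls × Fin k => γ e.1 * b e * (γ (e.1 + Pi.single e.2 1))⁻¹) ∂(rectSliceMeasure G Ls) =
      ∫ b, (fun c => rectSliceKernel (Ls := Ls) ρ J J a c * φ c)
        (fun e : RectTorusSite Ls × Fin k => γ e.1 * b e * (γ (e.1 + Pi.single e.2 1))⁻¹) ∂(rectSliceMeasure G Ls) := by
    refine integral_congr_ae (Eventually.of_forall fun b => ?_)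
    simp only [rectSliceKernel_gauge_right]
  have hg : AEStronglyMeasurable (fun c => rectSliceKernel (Ls := Ls) ρ J J a c * φ c) (rectSliceMeasure G Ls) :=
    ((Continuous.comp (g := uncurry (rectSliceKernel (Ls := Ls) ρ J J)) (f := fun c => (a, c)) hKc
      (Continuous.prodMk continuous_const continuous_id)).aestronglyMeasurable).mul (Lp.aestronglyMeasurable φ)
  have h3 : ∫ b, (fun c => rectSliceKernel (Ls := Ls) ρ J J a c * φ c)
        (fun e : RectTorusSite Ls × Fin k => γ e.1 * b e * (γ (e.1 + Pi.single e.2 1))⁻¹) ∂(rectSliceMeasure G Ls) =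
      ∫ c, rectSliceKernel (Ls := Ls) ρ J J a c * φ c ∂(rectSliceMeasure G Ls) := by
    have hg' : AEStronglyMeasurable (fun c => rectSliceKernel (Ls := Ls) ρ J J a c * φ c)
        (Measure.map
          (fun (U : RectSlice Ls G) (e : RectTorusSite Ls × Fin k) => γ e.1 * U e * (γ (e.1 + Pi.single e.2 1))⁻¹)
          (rectSliceMeasure G Ls)) := by
      rw [hmp.map_eq]; exact hg
    have := integral_map hmp.measurable.aemeasurable hg'
    rw [hmp.map_eq] at this
    exact this.symm
  dsimp only
  rw [h1, h2, h3]

/-- **`G_γ ∘ T = T`** on the rectangular tube: the image of `T` consists of gauge-invariant functions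
(continuous unitary `ρ`). [cite: Luscher1977] [cite: MontvayMunster1994, §3.2.6 (3.137)–(3.146)] -/
theorem gaugeOp_comp_rectTubeTransferOperator (hρ : Continuous ρ) (hρu : ∀ g, ρ g ∈ Matrix.unitaryGroup (Fin n) ℂ)
    (γ : RectTorusSite Ls → G) :
    (Lp.compMeasurePreservingₗᵢ ℝ
          (fun (U : RectSlice Ls G) (e : RectTorusSite Ls × Fin k) => γ e.1 * U e * (γ (e.1 + Pi.single e.2 1))⁻¹)
          (measurePreserving_rectGauge γ)).toContinuousLinearMap.comp
        (rectTubeTransferOperator ρ J Ls) = rectTubeTransferOperator ρ J Ls := by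
  have hmp : MeasurePreserving
      (fun (U : RectSlice Ls G) (e : RectTorusSite Ls × Fin k) => γ e.1 * U e * (γ (e.1 + Pi.single e.2 1))⁻¹)
      (rectSliceMeasure G Ls) (rectSliceMeasure G Ls) := measurePreserving_rectGauge γ
  refine ContinuousLinearMap.ext fun φ => Lp.ext ?_
  rw [ContinuousLinearMap.comp_apply]
  refine (Lp.coeFn_compMeasurePreserving _ hmp).trans ?_
  refine (hmp.quasiMeasurePreserving.ae_eq_comp (rectTubeTransferOperator_ae_eq J Ls hρ φ)).trans
    ((rectTubeTransferOperator_ae_eq J Ls hρ φ).trans ?_).symm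
  refine Eventually.of_forall fun a => ?_
  simp only [Function.comp_apply, rectSliceKernel_gauge_left ρ hρu]

/-- **Gauge invariance of the image, pointwise form**: for every `φ ∈ L²`, `(Tφ)(a^γ) = (Tφ)(a)` for a.e. `a`
(continuous unitary `ρ`). [cite: Luscher1977] -/
theorem rectTubeTransferOperator_apply_gauge_ae (hρ : Continuous ρ) (hρu : ∀ g, ρ g ∈ Matrix.unitaryGroup (Fin n) ℂ)
    (γ : RectTorusSite Ls → G) (φ : Lp ℝ 2 (rectSliceMeasure G Ls)) :
    (fun a => (rectTubeTransferOperator ρ J Ls φ : RectSlice Ls G → ℝ)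
        (fun e : RectTorusSite Ls × Fin k => γ e.1 * a e * (γ (e.1 + Pi.single e.2 1))⁻¹)) =ᵐ[rectSliceMeasure G Ls]
      (rectTubeTransferOperator ρ J Ls φ : RectSlice Ls G → ℝ) := by
  have hmp : MeasurePreserving
      (fun (U : RectSlice Ls G) (e : RectTorusSite Ls × Fin k) => γ e.1 * U e * (γ (e.1 + Pi.single e.2 1))⁻¹)
      (rectSliceMeasure G Ls) (rectSliceMeasure G Ls) := measurePreserving_rectGauge γ
  refine (hmp.quasiMeasurePreserving.ae_eq_comp (rectTubeTransferOperator_ae_eq J Ls hρ φ)).trans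
    ((rectTubeTransferOperator_ae_eq J Ls hρ φ).trans ?_).symm
  refine Eventually.of_forall fun a => ?_
  simp only [Function.comp_apply, rectSliceKernel_gauge_left ρ hρu]

end Operator

end Summit.Ventures.YMGap.FlowData
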